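import Summits.NavierStokesRegularity.NavierStokesRegularity.Theorems.FrequencyRigidity.Negative.SelfSimilarSwirl
import Literature.Analysis.FluidPDE.PineauVicolRDSSLeray
import Literature.Analysis.FluidPDE.PineauVicolEnstrophyTime
import Literature.Analysis.FluidPDE.TsaiSelfSimilarBounded

/-!
# `FrequencyRigidity` (crux `stmt-NavierStokesRegularity-2955`, route `AdaptedFrequency`):
# THE WALL — the crux contains the bounded-profile ROTATED-self-similar Liouville problem for
# every angular speed `α`, modulo co-rotating kernels (negative-side support, refuter cdisprove)

`AdaptedFrequency.FrequencyRigidity = ¬ ∃ (ν C Λ₀ v q K), …`: no smooth ancient Navier–Stokes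
flow on `ℝ³ × (−∞,0)` with the GLOBAL Type-I bound, an adapted Gaussian-comparable kernel at
`(0,0)`, positive adapted enstrophy and constant adapted frequency.  Every triager of the crux
panel, every line card and the lead's `PICKED.md` locate the same wall behind the crux (and behind
Stub 3 `stub_flatEnstrophyLiouville` of the picked line `two-ended-pinning`): the Liouville
problem for backward ROTATED self-similar (RSS) flows `u = (−t)^{−1/2} R(αs) U(R(−αs)x/√(−t))`,
`s = −log(−t)` (Pineau–Vicol 2026 ansatz (1.7), the tree's `pvAnsatz α`), which is Perelman's
conjecture = Tsai GSM 192 Conj. 8.9 = Bradshaw–Tsai 2017 OP 5.2 = Pineau–Vicol 2026 Conj. 1.1,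
OPEN for `α ≈ 1` (known: `α = 0`, Tsai 1998 Thm 1, in the tree and PROVED:
`tsai_selfsimilar_bounded_holds`; `|α| ≪ 1`, `|α| ≫ 1` in the decaying class, Pineau–Vicol Thm 1.4,
named fact `pineauVicol2026_rss_liouville`).  This file makes that folklore reduction a CHECKED
implication, so that the lead's eventual `promote-stub` of Stub 3 can cite a theorem:

* `RSSLiouvilleBounded α` — the bounded-profile RSS Liouville statement at speed `α`: every
  smooth profile `U` with `U`, `DU` bounded whose RSS field `rss α U = pvAnsatz α U` is a classical
  Navier–Stokes flow (viscosity `1`, some pressure) on `(−∞,0)` is irrotational, `curl U ≡ 0`.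
  (Bounded profiles without decay: for `α = 0` this is exactly Tsai's `q = ∞` theorem —
  `rssLiouvilleBounded_zero`, PROVED here from the tree; for `α ≠ 0` it contains Pineau–Vicol's
  Conjecture 1.1 on its window and is open.)
* `CoRotatingKernelHypothesis α` — H: such a flow admits an adapted backward kernel on `(−∞,0)`
  at `(0,0)` (the crux's five clauses, `IsAdaptedBackwardKernel`), two-sided Gaussian-comparable,
  of the CO-ROTATING SELF-SIMILAR form `K(t,x) = (−t)^{−3/2} 𝒦(R(−αs)x/√(−t))` (`IsCoRotating`).
  In similarity variables `𝒦` is the invariant probability density of the Ornstein–Uhlenbeck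
  drift `−½z` perturbed by the bounded divergence-free field `−U` and the rotation `αJz`
  (Lyapunov function `‖z‖²`); its existence, smoothness, positivity and two-sided Gaussian bounds
  are standard in the theory of invariant measures of Kolmogorov operators with bounded drift
  perturbations, but NOT in the tree — so it is carried as a hypothesis, not asserted.  It is at
  least CONSISTENT: on the toroidal class (`⟪y, U y⟫ = 0`) the backward heat kernel is such a
  kernel for every `α` (`coRotatingKernel_of_tangent`).
* **`rssLiouvilleBounded_of_frequencyRigidity :
    CoRotatingKernelHypothesis α → FrequencyRigidity → RSSLiouvilleBounded α`** (every `α`).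
  Proof: for an RSS flow with a co-rotating kernel the adapted enstrophy is EXACTLY
  `H(t) = A(−t)^{−2}`, `A = ∫ ‖curl U‖² 𝒦` (`adaptedEnstrophy_rss`: parabolic scaling of the
  Bochner integral + rotation invariance of Lebesgue measure + `‖R ω‖ = ‖ω‖`), so either `A = 0`
  — and then `curl U ≡ 0` by continuity and `𝒦 > 0` — or `Λ ≡ 2`, `H > 0`, the profile bound is
  the global Type-I bound (`typeIBound_rss`), and `(1, C, 2, rss α U, q, K)` inhabits the `∃` the
  crux negates.

MESSAGE FOR PROVERS / THE LEAD.  Any proof of the crux (equivalently of Stub 3, whose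
`IsFlatInhabitant` such a flow is, with `A > 0` — cf. the stub's own docstring) proves, for EVERY
`α`, the bounded-profile RSS Liouville theorem modulo the kernel fact H; in particular it settles
Pineau–Vicol's Conjecture 1.1 on the open window `α ≈ 1` (bounded-gradient class).  Conversely
nothing here refutes the crux: a counterexample needs a NON-TRIVIAL bounded RSS (or other Type-I
ancient) profile, equally open.  The frequency functional cannot see `α` (`H = A(−t)^{−2}` for all
speeds), so no sharpening of the frequency clause narrows the window.  Companion files: `Clauses`
(A), `RigidRotation` (B), `SelfSimilarSwirl` (C), `FrequencyStructure` (T), `SmallLocalTypeI` (B′),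
`BreathingSwirl*` (R), and the other seat's `TwoEndedPinningStubs`, `LinearStrainFlow`; the crux
work-file `Cruxes/FrequencyRigidity/Disproof.lean` indexes them.  No `¬`-theorem of a Theses decl
is claimed and nothing here asserts a route statement positively.

## References

* B. Pineau, V. Vicol, arXiv:2607.09619 (2026), §1.2 (1.7)–(1.10), Conjecture 1.1, Theorem 1.4.
  [PineauVicol2026]
* T.-P. Tsai, Arch. Ration. Mech. Anal. 143 (1998) 29–51, Thm 1 (`q = ∞`). [Tsai1998]
* Z. Bradshaw, T.-P. Tsai, Comm. PDE 42 (2017), §5, Open Problem 5.2. [BradshawTsai2017CPDE]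
* G. Koch, N. Nadirashvili, G. Seregin, V. Šverák, Acta Math. 203 (2009) 83–105, §1
  (Liouville conjectures for bounded ancient solutions). [KochNadirashviliSereginSverak2009]
-/

noncomputable section

set_option linter.dupNamespace false

namespace Summit.NavierStokesRegularity.NavierStokesRegularity.Theorems.FrequencyRigidity.Negative

open Literature.Analysis.FluidPDE Literature.Analysis.UnboundedOperators
open MeasureTheory Set Filter Topology Function
open scoped Laplacian InnerProductSpace RealInnerProductSpace ContDiff

/-! ### RSS flows, their vorticity, the Type-I bound -/

/-- **The rotated self-similar (RSS) field** with angular speed `α` and time-independent profile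
`U` (viscosity `1`): `rss α U t x = (−t)^{−1/2} R(αs) U(R(−αs) x/√(−t))`, `s = −log(−t)` — the
tree's Pineau–Vicol ansatz `pvAnsatz α` with an `s`-independent profile. -/
def rss (α : ℝ) (U : E3 → E3) : ℝ → E3 → E3 :=
  pvAnsatz α fun y _ => U y

/-- The pattern angle `θ(t) = α s`, `s = −log(−t)`. -/
def rotAngle (α t : ℝ) : ℝ :=
  α * -Real.log (-t)

/-- Unfolding: `rss α U t x = sc(t) R_θ U(R_{−θ}(sc(t) x))`, `sc(t) = (−t)^{−1/2}`. -/
theorem rss_apply (α : ℝ) (U : E3 → E3) (t : ℝ) (x : E3) :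
    rss α U t x = sc t • rotZ (rotAngle α t) (U (rotZ (-rotAngle α t) (sc t • x))) :=
  rfl

/-- At `t = −1` (`s = 0`) the RSS field is its profile. -/
theorem rss_neg_one (α : ℝ) (U : E3 → E3) (x : E3) : rss α U (-1) x = U x := by
  simp [rss, pvAnsatz]

/-- Rotation conjugates `R_θ ∘ U ∘ R_{−θ}` of a differentiable profile are differentiable. -/
theorem differentiable_rotZ_conj {U : E3 → E3} (hU : Differentiable ℝ U) (θ : ℝ) :
    Differentiable ℝ fun y => rotZ θ (U (rotZ (-θ) y)) := by
  have e : (fun y => rotZ θ (U (rotZ (-θ) y))) = (rotZL θ) ∘ U ∘ (rotZL (-θ)) := by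
    funext y; simp [Function.comp]
  rw [e]
  exact (rotZL θ).differentiable.comp (hU.comp (rotZL (-θ)).differentiable)

/-- **Vorticity of an RSS slice**: `curl (rss α U t)(x) = (−t)⁻¹ R_θ (curl U)(R_{−θ} x/√(−t))`
(parabolic scaling `curl (c W(c·)) = c² (curl W)(c·)` and rotation equivariance of the curl). -/
theorem curl_rss {U : E3 → E3} (hU : Differentiable ℝ U) (α t : ℝ) (x : E3) :
    curl (rss α U t) x =
      (sc t * sc t) • rotZ (rotAngle α t) (curl U (rotZ (-rotAngle α t) (sc t • x))) := by
  have e : rss α U t =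
      fun z => sc t • (fun y => rotZ (rotAngle α t) (U (rotZ (-rotAngle α t) y))) (sc t • z) :=
    rfl
  rw [e, curl_smul_comp_smul (W := fun y => rotZ (rotAngle α t) (U (rotZ (-rotAngle α t) y)))
    (sc t) x ((differentiable_rotZ_conj hU _) _), PineauVicol2026.curl_rotZ_conj hU]

/-- `‖curl (rss α U t)(x)‖² = (−t)^{−2} ‖(curl U)(R_{−θ} x/√(−t))‖²`. -/
theorem norm_curl_rss_sq {U : E3 → E3} (hU : Differentiable ℝ U) (α t : ℝ) (x : E3) :
    ‖curl (rss α U t) x‖ ^ 2 = sc t ^ 4 * ‖curl U (rotZ (-rotAngle α t) (sc t • x))‖ ^ 2 := by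
  rw [curl_rss hU, norm_smul, norm_rotZ, Real.norm_eq_abs, abs_mul_self]
  ring

/-- **A bounded profile gives the GLOBAL Type-I bound** `‖rss α U t x‖ ≤ C/√(−t)`
(`‖R v‖ = ‖v‖`). -/
theorem typeIBound_rss {α C : ℝ} {U : E3 → E3} (hC : ∀ y, ‖U y‖ ≤ C) :
    TypeIBound C (rss α U) := by
  intro t ht x
  have hsc := sc_pos (neg_pos.2 (show t < 0 from ht))
  rw [rss_apply, norm_smul, norm_rotZ, Real.norm_of_nonneg hsc.le]
  calc sc t * ‖U (rotZ (-rotAngle α t) (sc t • x))‖ ≤ sc t * C :=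
        mul_le_mul_of_nonneg_left (hC _) hsc.le
    _ = C / Real.sqrt (-t) := by rw [sc, div_eq_mul_inv, mul_comm]

/-! ### Co-rotating self-similar kernels and the exact power law `H = A(−t)^{−2}` -/

/-- **Co-rotating self-similar kernels**: `K(t, x) = (−t)^{−3/2} 𝒦(R(−αs) x/√(−t))` with
`𝒦 = K(−1, ·)` — the shape of the natural (invariant-density) kernel of an RSS drift. -/
def IsCoRotating (α : ℝ) (K : ℝ → E3 → ℝ) : Prop :=
  ∀ t < 0, ∀ x, K t x = sc t ^ 3 * K (-1) (rotZ (-rotAngle α t) (sc t • x))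

/-- **Exact power law.**  For an RSS field and a co-rotating kernel the adapted enstrophy is
`H(t) = A / t²`, `A = ∫ ‖curl U‖² K(−1)` — whatever the angular speed `α` (substitute
`z = R_{−θ} x/√(−t)`: parabolic scaling of the Bochner integral and rotation invariance of
Lebesgue measure). -/
theorem adaptedEnstrophy_rss {α : ℝ} {U : E3 → E3} (hU : Differentiable ℝ U) {K : ℝ → E3 → ℝ}
    (hK : IsCoRotating α K) {t : ℝ} (ht : t < 0) :
    (∫ x, ‖curl (rss α U t) x‖ ^ 2 * K t x) = (∫ z, ‖curl U z‖ ^ 2 * K (-1) z) / t ^ 2 := by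
  have hsc := sc_pos (neg_pos.2 ht)
  set θ : ℝ := rotAngle α t with hθ
  set f : E3 → ℝ := fun z => ‖curl U z‖ ^ 2 * K (-1) z with hf
  set g : E3 → ℝ := fun y => f (rotZ (-θ) y) with hg
  have h1 : ∀ x, ‖curl (rss α U t) x‖ ^ 2 * K t x = sc t ^ 7 * g (sc t • x) := fun x => by
    rw [norm_curl_rss_sq hU, hK t ht x]
    simp only [hg, hf, ← hθ]
    ring
  simp_rw [h1, integral_const_mul]
  rw [Measure.integral_comp_smul volume g (sc t)]
  simp only [finrank_euclideanSpace_fin, smul_eq_mul]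
  have hmp : MeasurePreserving (rotZLIE (-θ) : E3 → E3) volume volume :=
    (rotZLIE (-θ)).measurePreserving
  have hcomp : ∫ y, g y = ∫ z, f z :=
    hmp.integral_comp (rotZLIE (-θ)).toHomeomorph.measurableEmbedding f
  rw [abs_of_pos (inv_pos.2 (pow_pos hsc 3)), hcomp, div_eq_mul_inv, ← sc_pow_four ht]
  field_simp

/-- **Constant frequency `Λ ≡ 2` from the exact power law** `H = A/t²`, `A > 0` (the frequency
clause of the crux, verbatim binders). -/
theorem freqClause_of_powerLaw {v : ℝ → E3 → E3} {K : ℝ → E3 → ℝ} {A : ℝ} (hA : 0 < A)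
    (hHt : ∀ t ∈ Iio (0:ℝ), (∫ x, ‖curl (v t) x‖ ^ 2 * K t x) = A / t ^ 2) :
    FreqClause v K 2 := by
  intro H Λ hH hΛ
  have hHt' : ∀ t ∈ Iio (0:ℝ), H t = A / t ^ 2 := fun t ht => by rw [hH]; exact hHt t ht
  refine ⟨fun t ht => ?_, fun t ht => ?_⟩
  · rw [hHt' t ht]
    have ht0 : t ≠ 0 := ne_of_lt ht
    positivity
  · have ht0 : t ≠ 0 := ne_of_lt ht
    have hev : H =ᶠ[𝓝 t] fun s => A * (s ^ 2)⁻¹ :=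
      Filter.eventuallyEq_of_mem (Iio_mem_nhds ht) fun s hs => by
        rw [hHt' s hs, div_eq_mul_inv]
    have hd : HasDerivAt (fun s : ℝ => A * (s ^ 2)⁻¹) (A * (-(2 * t) / (t ^ 2) ^ 2)) t := by
      have h1 : HasDerivAt (fun s : ℝ => s ^ 2) (2 * t) t := by simpa using hasDerivAt_pow 2 t
      exact (h1.inv (pow_ne_zero 2 ht0)).const_mul A
    rw [hΛ]
    dsimp only
    rw [hev.deriv_eq, hd.deriv, hHt' t ht]
    field_simp
    ring

/-! ### The wall -/

/-- **H — co-rotating kernels for RSS flows** at speed `α`: every smooth profile with `U`, `DU`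
bounded whose RSS field is a classical Navier–Stokes flow (viscosity `1`) on `(−∞,0)` admits an
adapted backward kernel on `(−∞,0)` with pole `(0,0)` (the crux's five clauses), two-sided
Gaussian-comparable, of co-rotating self-similar form.  (Expected from invariant-measure theory
for Ornstein–Uhlenbeck operators with bounded drift perturbations; not in the tree; CARRIED AS A
HYPOTHESIS, never asserted.) -/
def CoRotatingKernelHypothesis (α : ℝ) : Prop :=
  ∀ (U : E3 → E3) (q : ℝ → E3 → ℝ), ContDiff ℝ ∞ U →
    (∃ C : ℝ, ∀ y, ‖U y‖ ≤ C ∧ ‖fderiv ℝ U y‖ ≤ C) →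
    IsClassicalNSSolutionOn (Iio 0) 1 0 (rss α U) q →
    ∃ K : ℝ → E3 → ℝ, IsAdaptedBackwardKernel 1 (rss α U) (Iio 0) 0 0 K ∧
      IsGaussianComparable K (Iio 0) 0 0 ∧ IsCoRotating α K

/-- **The bounded-profile RSS Liouville statement at speed `α`**: a smooth profile with `U`, `DU`
bounded whose RSS field `rss α U` is a classical Navier–Stokes flow (viscosity `1`, some pressure)
on `ℝ³ × (−∞,0)` is irrotational.  For `α = 0`: Tsai 1998 (`rssLiouvilleBounded_zero`).  For
`α ≠ 0`: contains Pineau–Vicol 2026 Conjecture 1.1 (bounded-gradient class) — OPEN on the window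
`α ≈ 1`. -/
def RSSLiouvilleBounded (α : ℝ) : Prop :=
  ∀ (U : E3 → E3) (q : ℝ → E3 → ℝ), ContDiff ℝ ∞ U →
    (∃ C : ℝ, ∀ y, ‖U y‖ ≤ C ∧ ‖fderiv ℝ U y‖ ≤ C) →
    IsClassicalNSSolutionOn (Iio 0) 1 0 (rss α U) q → ∀ y, curl U y = 0

/-- **THE WALL.**  Modulo co-rotating kernels, the crux `FrequencyRigidity` implies the
bounded-profile rotated-self-similar Liouville theorem for EVERY angular speed `α` — in
particular Pineau–Vicol's Conjecture 1.1 on its open window.  (An RSS flow with a co-rotating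
kernel has `H(t) = A(−t)^{−2}` exactly; `A > 0` would inhabit the `∃` the crux negates, so `A = 0`,
i.e. `‖curl U‖² K(−1) ≡ 0` with `K(−1) > 0`.) -/
theorem rssLiouvilleBounded_of_frequencyRigidity {α : ℝ} (hker : CoRotatingKernelHypothesis α)
    (hFR : Theses.AdaptedFrequency.FrequencyRigidity) : RSSLiouvilleBounded α := by
  intro U q hU hbd hNS
  obtain ⟨C, hC⟩ := hbd
  obtain ⟨K, hK, hG, hco⟩ := hker U q hU ⟨C, hC⟩ hNS
  have hUd : Differentiable ℝ U := hU.differentiable (by simp)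
  have hm1 : (-1:ℝ) ∈ Iio (0:ℝ) := by norm_num
  have hKpos : ∀ x, 0 < K (-1) x := hK.pos (-1) hm1
  have hKint : Integrable (K (-1)) := hK.integrable hm1
  have hKcont : Continuous (K (-1)) := (hK.contDiff_slice hm1).continuous
  have hcurl : Continuous fun z => curl U z := continuous_curl (hU.of_le (by norm_cast))
  set f : E3 → ℝ := fun z => ‖curl U z‖ ^ 2 * K (-1) z with hf
  have hf_nonneg : ∀ z, 0 ≤ f z := fun z => mul_nonneg (sq_nonneg _) (hKpos z).le
  have hf_cont : Continuous f := (hcurl.norm.pow 2).mul hKcont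
  have hf_int : Integrable f := by
    refine hKint.bdd_mul (c := (‖curlCLM‖ * C) ^ 2) (hcurl.norm.pow 2).aestronglyMeasurable
      (Eventually.of_forall fun z => ?_)
    rw [Real.norm_of_nonneg (sq_nonneg _)]
    have h1 : ‖curl U z‖ ≤ ‖curlCLM‖ * C :=
      (norm_curl_le U z).trans (mul_le_mul_of_nonneg_left (hC z).2 (norm_nonneg curlCLM))
    exact pow_le_pow_left₀ (norm_nonneg _) h1 2
  set A : ℝ := ∫ z, f z with hA
  have hA0 : A = 0 := by
    by_contra hne
    have hApos : 0 < A := lt_of_le_of_ne (integral_nonneg hf_nonneg) (Ne.symm hne)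
    have hHt : ∀ t ∈ Iio (0:ℝ), (∫ x, ‖curl (rss α U t) x‖ ^ 2 * K t x) = A / t ^ 2 :=
      fun t ht => adaptedEnstrophy_rss hUd hco ht
    have hTI : TypeIBound C (rss α U) := typeIBound_rss fun y => (hC y).1
    have hKC : KernelClauses 1 (rss α U) K :=
      ⟨hK.contDiffOn, hK.pos, hK.adjoint_eq, hK.integral_eq_one, hK.tendsto_integral_mul⟩
    have hCo : Comparable K := isGaussianComparable_iff_fin_three.1 hG
    exact (frequencyRigidity_iff.1 hFR)
      ⟨1, C, 2, rss α U, q, K, one_pos, hNS, hTI, hKC, hCo, freqClause_of_powerLaw hApos hHt⟩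
  have hf0 : f = fun _ => 0 := by
    have hae : f =ᵐ[volume] (fun _ => (0:ℝ)) :=
      (integral_eq_zero_iff_of_nonneg (fun z => hf_nonneg z) hf_int).1 hA0
    exact (hf_cont.ae_eq_iff_eq volume continuous_const).1 hae
  intro y
  have hy : f y = 0 := by rw [hf0]
  rcases mul_eq_zero.1 hy with h | h
  · exact norm_eq_zero.1 ((pow_eq_zero_iff two_ne_zero).1 h)
  · exact absurd h (hKpos y).ne'

/-! ### Anchors: `α = 0` is Tsai's theorem; the kernel hypothesis holds on the toroidal class -/

/-- The Leray orbit of the non-rotating self-similar field `rss 0 U` is the `s`-independent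
profile `U`. -/
theorem lerayOrbit_rss_zero (U : E3 → E3) : lerayOrbit (rss 0 U) = fun _ : ℝ => U := by
  funext s z
  rw [rss, PineauVicol2026.lerayOrbit_pvAnsatz]
  simp

/-- **Leray's profile system from an arbitrary smooth pressure.**  If the self-similar field
`rss 0 U` of a smooth profile is a classical Navier–Stokes flow (viscosity `1`) on `(−∞,0)` with
SOME smooth pressure `q`, then `(U, P)` is a Leray profile with rate `a = ½` for the similarity
pressure slice `P = lerayOrbitPressure q 0` (the momentum equation of the backward Leray system at
`s = 0`; the time derivative of the `s`-independent orbit vanishes). -/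
theorem isLerayProfile_of_rss_zero {U : E3 → E3} {q : ℝ → E3 → ℝ} (hU : ContDiff ℝ ∞ U)
    (hNS : IsClassicalNSSolutionOn (Iio 0) 1 0 (rss 0 U) q) :
    IsLerayProfile 1 (1 / 2) U (lerayOrbitPressure q 0) := by
  have hL : IsBackwardLeraySolutionOn univ 1 (fun _ : ℝ => U) (lerayOrbitPressure q) := by
    rw [← lerayOrbit_rss_zero U]
    exact isClassicalNSSolutionOn_Iio_iff_isBackwardLeraySolutionOn.1 hNS
  have hP1 : ContDiff ℝ 1 (lerayOrbitPressure q 0) :=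
    (hL.smooth_pressure.contDiff_slice (mem_univ 0)).of_le (by norm_cast)
  refine ⟨hU.of_le (by norm_cast), hP1, fun z => ?_, hL.divFree 0 (mem_univ _)⟩
  have hm := hL.momentum_leray (mem_univ 0) z
  have hD : timeDerivWithin univ (fun (_ : ℝ) => U) 0 z = 0 := by
    simp only [timeDerivWithin_apply, derivWithin_fun_const, Pi.zero_apply]
  rw [hD, zero_add] at hm
  -- `hm : ½U + ½(z·∇)U + (U·∇)U + ∇P = 1 • ΔU`
  rw [← hm]
  abel

/-- **`α = 0` is known (Tsai 1998, Thm 1, `q = ∞`, PROVED in the tree):** a bounded smooth profile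
whose self-similar field is a classical Navier–Stokes flow on `(−∞,0)` (any smooth pressure) is
constant, hence irrotational.  (Via the tree's similarity variables: the Leray orbit of `rss 0 U`
is the `s`-independent profile `U`, the momentum equation at `s = 0` is Leray's profile system with
`a = ½`, and `tsai_selfsimilar_bounded_holds` applies.)  So the wall is exactly `α ≠ 0`. -/
theorem rssLiouvilleBounded_zero : RSSLiouvilleBounded 0 := by
  intro U q hU hbd hNS y
  obtain ⟨C, hC⟩ := hbd
  obtain ⟨c, hc⟩ := tsai_selfsimilar_bounded_holds one_pos (by norm_num : (0:ℝ) < 1 / 2)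
    (isLerayProfile_of_rss_zero hU hNS) ⟨C, fun z => (hC z).1⟩
  have hUc : U = fun _ => c := funext hc
  rw [hUc]
  exact curl_const c y

/-- Rotations about the axis preserve the inner product. -/
theorem inner_rotZ_rotZ (θ : ℝ) (a b : E3) : ⟪rotZ θ a, rotZ θ b⟫ = ⟪a, b⟫ := by
  rw [← rotZLIE_apply, ← rotZLIE_apply, LinearIsometryEquiv.inner_map_map]

/-- `R_θ R_{−θ} = 1`. -/
theorem rotZ_rotZ_neg (θ : ℝ) (y : E3) : rotZ θ (rotZ (-θ) y) = y := by
  rw [← rotZ_add, add_neg_cancel, rotZ_zero]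

/-- A toroidal profile (`⟪y, U y⟫ = 0`) has an RSS field tangent to the spheres about the pole. -/
theorem inner_self_rss {α : ℝ} {U : E3 → E3} (hU : ∀ y, ⟪y, U y⟫ = 0) (t : ℝ) (x : E3) :
    ⟪x, rss α U t x⟫ = 0 := by
  rw [rss_apply, inner_smul_right]
  set θ := rotAngle α t
  set z := rotZ (-θ) (sc t • x) with hz
  have hx : sc t • x = rotZ θ z := by rw [hz, rotZ_rotZ_neg]
  have h1 : ⟪sc t • x, rotZ θ (U z)⟫ = 0 := by rw [hx, inner_rotZ_rotZ, hU z]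
  rw [inner_smul_left] at h1
  rcases mul_eq_zero.1 h1 with h | h
  · by_cases ht : 0 < -t
    · exact absurd h (by simpa using (sc_pos ht).ne')
    · -- `t ≥ 0`: `sc t = 0`, the field vanishes
      have hsc : sc t = 0 := by
        rw [sc, Real.sqrt_eq_zero'.2 (not_lt.1 ht), inv_zero]
      simp [hsc]
  · rw [h, mul_zero]

/-- **The backward heat kernel is co-rotating self-similar** for every speed (it is radial and
parabolically self-similar). -/
theorem isCoRotating_backwardHeatKernel (α : ℝ) :
    IsCoRotating α (backwardHeatKernel 1 0 (0 : E3)) := by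
  intro t ht x
  rw [backwardHeatKernel_scaling one_pos ht]
  congr 1
  simp only [backwardHeatKernel, heatKernel, sub_neg_eq_add, zero_add, mul_one, sub_zero, norm_rotZ]

/-- **Consistency anchor for H.**  On the toroidal class `⟪y, U y⟫ = 0` the conclusion of
`CoRotatingKernelHypothesis` holds for every `α`, Navier–Stokes or not: the backward heat kernel
(viscosity `1`) is adapted to `rss α U` (the drift is tangent to the spheres about the pole),
Gaussian-comparable and co-rotating. -/
theorem coRotatingKernel_of_tangent {α : ℝ} {U : E3 → E3} (hU : ∀ y, ⟪y, U y⟫ = 0) :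
    ∃ K : ℝ → E3 → ℝ, IsAdaptedBackwardKernel 1 (rss α U) (Iio 0) 0 0 K ∧
      IsGaussianComparable K (Iio 0) 0 0 ∧ IsCoRotating α K := by
  have hK := isAdaptedBackwardKernel_backwardHeatKernel (E := E3) one_pos 0 0
  refine ⟨backwardHeatKernel 1 0 (0 : E3), ⟨hK.contDiffOn, hK.pos, fun t ht x => ?_,
    hK.integral_eq_one, hK.tendsto_integral_mul⟩, isGaussianComparable_backwardHeatKernel one_pos 0 0,
    isCoRotating_backwardHeatKernel α⟩
  have h0 := hK.adjoint_eq t ht x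
  simp only [Pi.zero_apply, map_zero, add_zero] at h0
  rw [fderiv_backwardHeatKernel_apply, inner_self_rss hU t x, mul_zero, add_zero]
  exact h0

end Summit.NavierStokesRegularity.NavierStokesRegularity.Theorems.FrequencyRigidity.Negative

end
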